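import Mathlib
import Literature.Analysis.ODE.SchrodingerODE
import Literature.Analysis.ODE.VariationOfParametersTail
import Literature.Analysis.ODE.VolterraRecessiveInverseSquare
import Literature.Analysis.ODE.InverseSquareDominantPair
import Literature.Analysis.ODE.SourcedRightInverse
import Literature.Analysis.ODE.InverseSquareExactChain
import HarnessLib

/-!
# The true non-radiative chain of `−∂² + V` for `V = ℓ(ℓ+1)ι² + O(x^{-5/2})`

Analysis/ODE support file (everything proved, no definitions). Let `ι` be smooth with `ι = 1/x` on
`[½, ∞)`, `V` continuous with `|V(x) − ℓ(ℓ+1)ι(x)²| ≤ A x^{-5/2}` for `x ≥ x₀ ≥ 1`, and let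
`c : ℕ → ℝ` satisfy the tower relations `(j−1)c_{j−2} = (j−2ℓ−1)c_j` (`j ≥ 2`), `c₁ = 0` if `ℓ ≥ 1`
(e.g. `c_j = ∏_{k<ℓ}(j−2k−1)`, `InverseSquareExactChain.lean`). Then (`exists_correctedChain`) there are
`C²` functions `ẽ_0, …, ẽ_ℓ : ℝ → ℝ` with, on `x > ½`,

  `ẽ_j'' = V ẽ_j + j(j−1) ẽ_{j−2}`,

and, beyond some `x₁ ≥ x₀`, `|ẽ_j − c_j ι^{ℓ−j}| ≤ K x^{j−ℓ−1/2}`,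
`|ẽ_j' − (c_j ι^{ℓ−j})'| ≤ K x^{j−ℓ−3/2}`. Consequently `Σ_i binom(m,i) ẽ_{m−i}(x) tⁱ` (`m ≤ ℓ`) are
EXACT solutions of `ψ_tt − ψ_xx + Vψ = 0` on `{x > ½}`, polynomial in `t`, shadowing the exact
inverse-square towers (`InverseSquareCorrectedTowers.lean`). Construction: `ẽ_j = c_jι^{ℓ−j} + δ_j` with
`δ_0 = R(−W e_0)` and `δ_j = R₁(−W e_j − j(j−1)δ_{j−2})` (`W = V − ℓ(ℓ+1)ι²`; `R, R₁` the sourced right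
inverses of `SourcedRightInverse.lean` built on the recessive/dominant pair of
`VolterraRecessiveInverseSquare.lean`, `InverseSquareTailDominant.lean`); the power bounds propagate
because every source is `O(x^{j−ℓ−5/2})`. Folklore ODE asymptotics (Hartman, Ch. XI); use: the true
t-polynomial kernel on the null-infinity side of the Regge–Wheeler channel estimate
`FixedModeChannels` (route PhotonSphereChannels, stmt-FinalStateConjecture-10048).
-/

noncomputable section

namespace Literature.Analysis.ODE

open MeasureTheory Set Filter Topology

section TrueChain

variable {ι V : ℝ → ℝ}

/-- Smallness of the Volterra functional `∫_{x}^∞ y|W| ≤ 1/8` beyond `max x₀ (256A²+1)` when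
`|W| ≤ A x^{-5/2}` on `[x₀,∞)`, `x₀ ≥ 1`. [folklore] -/
theorem volterra_small_of_rpow_tail {W : ℝ → ℝ} (hW : Continuous W) {A x₀ : ℝ} (hx₀ : 1 ≤ x₀)
    (hA : 0 ≤ A) (hWb : ∀ x, x₀ ≤ x → |W x| ≤ A * x ^ (-(5 / 2 : ℝ))) :
    IntegrableOn (fun y => y * |W y|) (Ioi (max x₀ (256 * A ^ 2 + 1))) ∧
      ∀ z, max x₀ (256 * A ^ 2 + 1) ≤ z → IntegrableOn (fun y => y * |W y|) (Ioi z) ∧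
        ∫ y in Ioi z, y * |W y| ≤ 1 / 8 := by
  set x₀' : ℝ := max x₀ (256 * A ^ 2 + 1) with hx₀'
  have h1 : x₀ ≤ x₀' := le_max_left _ _
  have h2 : 256 * A ^ 2 + 1 ≤ x₀' := le_max_right _ _
  -- pointwise domination by `A y^{-3/2}`
  have hdom : ∀ z, x₀' ≤ z → ∀ y ∈ Ioi z, abs (y * |W y|) ≤ A * y ^ (-(3 / 2 : ℝ)) := by
    intro z hz y hy
    have hy0 : x₀ ≤ y := h1.trans (hz.trans (le_of_lt hy))
    have hyp : 0 < y := by linarith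
    rw [abs_mul, abs_abs, abs_of_pos hyp]
    calc y * |W y| ≤ y * (A * y ^ (-(5 / 2 : ℝ))) := by gcongr; exact hWb y hy0
      _ = A * (y ^ (1 : ℝ) * y ^ (-(5 / 2 : ℝ))) := by rw [Real.rpow_one]; ring
      _ = A * y ^ (-(3 / 2 : ℝ)) := by rw [← Real.rpow_add hyp]; norm_num
  have hint : ∀ z, x₀' ≤ z → IntegrableOn (fun y => y * |W y|) (Ioi z) := by
    intro z hz
    have hz0 : 0 < z := by linarith
    refine Integrable.mono' ((integrableOn_Ioi_rpow_of_lt (a := -(3 / 2 : ℝ)) (by norm_num) hz0).const_mul A)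
      ((continuous_id.mul hW.abs).aestronglyMeasurable) ?_
    exact (ae_restrict_iff' measurableSet_Ioi).2 (Eventually.of_forall fun y hy => by
      rw [Real.norm_eq_abs]; exact hdom z hz y hy)
  refine ⟨hint x₀' le_rfl, fun z hz => ⟨hint z hz, ?_⟩⟩
  have hz0 : 0 < z := by linarith
  have hz1 : 256 * A ^ 2 + 1 ≤ z := h2.trans hz
  -- `∫_z^∞ y|W| ≤ 2 A z^{-1/2} ≤ 1/8`
  have hI : ∫ y in Ioi z, y * |W y| ≤ A * (2 * z ^ (-(1 / 2 : ℝ))) := by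
    calc ∫ y in Ioi z, y * |W y| ≤ ∫ y in Ioi z, A * y ^ (-(3 / 2 : ℝ)) := by
          refine setIntegral_mono_on (hint z hz)
            ((integrableOn_Ioi_rpow_of_lt (a := -(3 / 2 : ℝ)) (by norm_num) hz0).const_mul A)
            measurableSet_Ioi ?_
          intro y hy
          exact (le_abs_self _).trans (hdom z hz y hy)
      _ = A * (2 * z ^ (-(1 / 2 : ℝ))) := by
          rw [MeasureTheory.integral_const_mul, integral_Ioi_rpow_of_lt (a := -(3 / 2 : ℝ)) (by norm_num) hz0]
          congr 1
          rw [show (-(3 / 2 : ℝ)) + 1 = -(1 / 2 : ℝ) by norm_num]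
          ring
  refine hI.trans ?_
  -- `16 A ≤ √z`
  set s : ℝ := z ^ ((1 / 2 : ℝ)) with hs
  have hs0 : 0 < s := Real.rpow_pos_of_pos hz0 _
  have h16 : 16 * A ≤ s := by
    have hsq : (16 * A) ^ 2 ≤ z := by nlinarith
    have h := Real.rpow_le_rpow (by positivity : (0 : ℝ) ≤ (16 * A) ^ 2) hsq
      (by norm_num : (0 : ℝ) ≤ 1 / 2)
    rw [show ((1 / 2 : ℝ)) = ((2 : ℕ) : ℝ)⁻¹ by norm_num,
      Real.pow_rpow_inv_natCast (by positivity : (0 : ℝ) ≤ 16 * A) two_ne_zero] at h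
    rw [hs, show ((1 / 2 : ℝ)) = ((2 : ℕ) : ℝ)⁻¹ by norm_num]
    exact h
  have hneg : z ^ (-(1 / 2 : ℝ)) = s⁻¹ := by rw [hs, Real.rpow_neg hz0.le]
  rw [hneg, show A * (2 * s⁻¹) = 2 * A / s by ring, div_le_iff₀ hs0]
  linarith

/-- **The true non-radiative chain.** See the module docstring. [folklore] -/
theorem exists_correctedChain (hι : ContDiff ℝ (⊤ : ℕ∞) ι) (hιeq : ∀ x : ℝ, 1 / 2 ≤ x → ι x = x⁻¹)
    (hV : Continuous V) (ℓ : ℕ) {c : ℕ → ℝ}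
    (hc : ∀ j : ℕ, 2 ≤ j → ((j : ℝ) - 1) * c (j - 2) = ((j : ℝ) - 2 * ℓ - 1) * c j)
    (hc1 : 1 ≤ ℓ → c 1 = 0) {A x₀ : ℝ} (hx₀ : 1 ≤ x₀)
    (hWb : ∀ x, x₀ ≤ x → |V x - ℓ * (ℓ + 1) * ι x ^ 2| ≤ A * x ^ (-(5 / 2 : ℝ))) :
    ∃ (et : ℕ → ℝ → ℝ) (x₁ K : ℝ), x₀ ≤ x₁ ∧ 0 ≤ K ∧
      (∀ j, j ≤ ℓ → ContDiff ℝ 2 (et j)) ∧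
      (∀ j, j ≤ ℓ → ∀ x, 1 / 2 < x →
        deriv (deriv (et j)) x = V x * et j x + (j : ℝ) * (j - 1) * et (j - 2) x) ∧
      (∀ j, j ≤ ℓ → ∀ x, x₁ ≤ x →
        |et j x - c j * ι x ^ (ℓ - j)| ≤ K * x ^ ((j : ℝ) - ℓ - 1 / 2) ∧
        |deriv (et j) x - deriv (fun y => c j * ι y ^ (ℓ - j)) x| ≤ K * x ^ ((j : ℝ) - ℓ - 3 / 2)) := by
  -- Step 0: the tail `W` and the decomposition of `V`
  set W : ℝ → ℝ := fun x => V x - ℓ * (ℓ + 1) * ι x ^ 2 with hW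
  have hWc : Continuous W := hV.sub (continuous_const.mul (hι.continuous.pow 2))
  have hx₀0 : 0 < x₀ := by linarith
  have hA : 0 ≤ A := nonneg_of_abs_le_mul_rpow hx₀0 (hWb x₀ le_rfl)
  have hVW : ∀ x, x₀ ≤ x → V x = (ℓ : ℝ) * (ℓ + 1) / x ^ 2 + W x := by
    intro x hx
    simp only [hW, hιeq x (by linarith), inv_pow]
    ring
  -- Step 1: Volterra smallness beyond `x₀'`
  obtain ⟨hWi, hsmall⟩ := volterra_small_of_rpow_tail hWc hx₀ hA hWb
  set x₀' : ℝ := max x₀ (256 * A ^ 2 + 1) with hx₀'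
  have hx₀'1 : 1 ≤ x₀' := hx₀.trans (le_max_left _ _)
  have hx₀'0 : x₀ ≤ x₀' := le_max_left _ _
  obtain ⟨-, hQ⟩ := hsmall x₀' le_rfl
  -- Step 2: the recessive solution and its partner
  obtain ⟨u₀, hu₀, hb₀, hb₀'⟩ := exists_isSchrodingerSol_recessive_inverseSquare hV hWc hx₀'1 ℓ
    (fun x hx => hVW x (hx₀'0.trans hx)) hWi hQ
  have h38 : ∀ x, x₀' < x → |x ^ ℓ * u₀ x - 1| ≤ 3 / 8 := fun x hx =>
    (hb₀ x hx).trans (by linarith [(hsmall x hx.le).2])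
  have h14 : ∀ x, x₀' < x → |deriv u₀ x + ℓ * x ^ (-(ℓ : ℤ) - 1)| ≤ 1 / 4 * x ^ (-(ℓ : ℤ) - 1) := by
    intro x hx
    refine (hb₀' x hx).trans ?_
    have hz : 0 ≤ x ^ (-(ℓ : ℤ) - 1) := (zpow_pos (by linarith) _).le
    have := (hsmall x hx.le).2
    nlinarith
  obtain ⟨u₁, hu₁, hw, hpair⟩ := exists_fundamental_pair_rpow hV hx₀'1 hu₀ h38 h14
  set x₁ : ℝ := x₀' + 1 with hx₁
  have hx₁1 : 1 ≤ x₁ := by linarith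
  have b₀ : ∀ x, x₁ ≤ x → |u₀ x| ≤ ((ℓ : ℝ) + 2) * x ^ (-(ℓ : ℝ)) := fun x hx => (hpair x hx).1
  have b₀' : ∀ x, x₁ ≤ x → |deriv u₀ x| ≤ ((ℓ : ℝ) + 2) * x ^ (-(ℓ : ℝ) - 1) :=
    fun x hx => (hpair x hx).2.1
  have b₁ : ∀ x, x₁ ≤ x → |u₁ x| ≤ 5 * x ^ ((ℓ : ℝ) + 1) := fun x hx => (hpair x hx).2.2.1
  have b₁' : ∀ x, x₁ ≤ x → |deriv u₁ x| ≤ 5 * x ^ (ℓ : ℝ) := fun x hx => (hpair x hx).2.2.2.1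
  -- Step 3: the exact chain and its products with `W`
  set e : ℕ → ℝ → ℝ := fun j y => c j * ι y ^ (ℓ - j) with he
  have heC : ∀ j, ContDiff ℝ 2 (e j) := fun j => contDiff_const_mul_iota_pow hι (ℓ - j) (c j)
  have hec : ∀ j, Continuous (e j) := fun j => (heC j).continuous
  have hWe : ∀ j, j ≤ ℓ → ∀ y, x₁ ≤ y → |W y * e j y| ≤ A * |c j| * y ^ ((j : ℝ) - ℓ - 5 / 2) := by
    intro j hj y hy
    have hy1 : 1 ≤ y := hx₁1.trans hy
    have hy0 : 0 < y := by linarith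
    obtain ⟨hab, -⟩ := exact_chain_bounds hιeq ℓ c hj hy1
    rw [abs_mul, hab, show (j : ℝ) - ℓ - 5 / 2 = -(5 / 2 : ℝ) + ((j : ℝ) - ℓ) by ring,
      Real.rpow_add hy0]
    calc |W y| * (|c j| * y ^ ((j : ℝ) - ℓ)) ≤ (A * y ^ (-(5 / 2 : ℝ))) * (|c j| * y ^ ((j : ℝ) - ℓ)) := by
          gcongr; exact hWb y (by linarith)
      _ = A * |c j| * (y ^ (-(5 / 2 : ℝ)) * y ^ ((j : ℝ) - ℓ)) := by ring
  -- Step 4: the correction chain `δ`, by induction on the length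
  have main : ∀ n, n ≤ ℓ → ∃ (δ : ℕ → ℝ → ℝ) (K : ℝ), 0 ≤ K ∧ ∀ j, j ≤ n →
      ContDiff ℝ 2 (δ j) ∧
      (∀ x, HasDerivAt (deriv (δ j))
        (V x * δ j x + W x * e j x + (j : ℝ) * (j - 1) * δ (j - 2) x) x) ∧
      (∀ x, x₁ ≤ x → |δ j x| ≤ K * x ^ ((j : ℝ) - ℓ - 1 / 2) ∧
        |deriv (δ j) x| ≤ K * x ^ ((j : ℝ) - ℓ - 3 / 2)) := by
    intro n
    induction n with
    | zero =>
      intro _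
      -- `δ₀ = R(−W e₀)`, top range `q = −ℓ − 5/2`
      have hf : Continuous fun y => -(W y * e 0 y) := (hWc.mul (hec 0)).neg
      have hfB : ∀ y, x₁ ≤ y → |(fun y => -(W y * e 0 y)) y| ≤ A * |c 0| * y ^ ((0 : ℝ) - ℓ - 5 / 2) := by
        intro y hy
        have := hWe 0 (Nat.zero_le _) y hy
        simp only [abs_neg, Nat.cast_zero] at this ⊢
        exact this
      obtain ⟨g, hg2, hgsol, hgb⟩ := exists_sourcedSol_rpow_top hV hu₀ hu₁ hw hx₁1 ℓ b₀ b₀' b₁ b₁'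
        (q := (0 : ℝ) - ℓ - 5 / 2) (by linarith) hf hfB
      set K : ℝ := ((ℓ : ℝ) + 2) * 5 * (1 / (ℓ - ((0 : ℝ) - ℓ - 5 / 2) - 1)
        + 1 / (-((0 : ℝ) - ℓ - 5 / 2) - ℓ - 2)) * (A * |c 0|) with hK
      have hK0 : 0 ≤ K := by
        have h1 : (0 : ℝ) < ℓ - ((0 : ℝ) - ℓ - 5 / 2) - 1 := by
          linarith [(Nat.cast_nonneg ℓ : (0 : ℝ) ≤ ℓ)]
        have h2 : (0 : ℝ) < -((0 : ℝ) - ℓ - 5 / 2) - ℓ - 2 := by linarith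
        positivity
      refine ⟨fun _ => g, K, hK0, fun j hj => ?_⟩
      obtain rfl : j = 0 := Nat.le_zero.1 hj
      refine ⟨hg2, fun x => ?_, fun x hx => ?_⟩
      · refine (hgsol x).congr_deriv ?_
        push_cast; ring
      · obtain ⟨h1, h2⟩ := hgb x hx
        rw [show (0 : ℝ) - ℓ - 5 / 2 + 2 = (0 : ℝ) - ℓ - 1 / 2 by ring] at h1
        rw [show (0 : ℝ) - ℓ - 5 / 2 + 1 = (0 : ℝ) - ℓ - 3 / 2 by ring] at h2
        refine ⟨?_, ?_⟩
        · simpa [hK] using h1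
        · simpa [hK] using h2
    | succ n ih =>
      intro hn
      obtain ⟨δ, K, hK0, hδ⟩ := ih (Nat.le_of_succ_le hn)
      -- the source `−W e_j − j(j−1) δ_{j−2}` for `j = n + 1`
      set j : ℕ := n + 1 with hjdef
      have hj1 : (1 : ℝ) ≤ j := by simp only [hjdef]; push_cast; linarith
      have hjℓ : j ≤ ℓ := hn
      obtain ⟨hdC, -, hdb⟩ := hδ (j - 2) (by omega)
      set d : ℝ → ℝ := δ (j - 2) with hd
      have hf : Continuous fun y => -(W y * e j y) - (j : ℝ) * (j - 1) * d y :=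
        (hWc.mul (hec j)).neg.sub (continuous_const.mul hdC.continuous)
      have hdterm : ∀ y, x₁ ≤ y →
          |(j : ℝ) * (j - 1) * d y| ≤ (j : ℝ) * (j - 1) * K * y ^ ((j : ℝ) - ℓ - 5 / 2) := by
        intro y hy
        rcases Nat.eq_zero_or_pos n with hn0 | hn0
        · have : (j : ℝ) * (j - 1) = 0 := by simp only [hjdef, hn0]; norm_num
          rw [this]; simp
        · have hcast : (((j - 2 : ℕ) : ℝ)) = (j : ℝ) - 2 := by
            rw [Nat.cast_sub (by omega)]; norm_num
          have h := (hdb y hy).1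
          rw [hcast, show (j : ℝ) - 2 - ℓ - 1 / 2 = (j : ℝ) - ℓ - 5 / 2 by ring] at h
          have hjj : 0 ≤ (j : ℝ) * (j - 1) := by nlinarith
          rw [abs_mul, abs_of_nonneg hjj, mul_assoc ((j : ℝ) * (j - 1)) K]
          exact mul_le_mul_of_nonneg_left h hjj
      have hfB : ∀ y, x₁ ≤ y → |(fun y => -(W y * e j y) - (j : ℝ) * (j - 1) * d y) y|
          ≤ (A * |c j| + (j : ℝ) * (j - 1) * K) * y ^ ((j : ℝ) - ℓ - 5 / 2) := by
        intro y hy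
        calc |-(W y * e j y) - (j : ℝ) * (j - 1) * d y|
            ≤ |-(W y * e j y)| + |(j : ℝ) * (j - 1) * d y| := abs_sub _ _
          _ ≤ A * |c j| * y ^ ((j : ℝ) - ℓ - 5 / 2) + (j : ℝ) * (j - 1) * K * y ^ ((j : ℝ) - ℓ - 5 / 2) := by
              rw [abs_neg]; exact add_le_add (hWe j hjℓ y hy) (hdterm y hy)
          _ = (A * |c j| + (j : ℝ) * (j - 1) * K) * y ^ ((j : ℝ) - ℓ - 5 / 2) := by ring
      obtain ⟨g, hg2, hgsol, hgb⟩ := exists_sourcedSol_rpow_mid hV hu₀ hu₁ hw hx₁1 ℓ b₀ b₀' b₁ b₁'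
        (q := (j : ℝ) - ℓ - 5 / 2) (by linarith) (by linarith [(Nat.cast_le.2 hjℓ : (j : ℝ) ≤ ℓ)])
        hf hfB
      set Km : ℝ := ((ℓ : ℝ) + 2) * 5 * (1 / (ℓ - ((j : ℝ) - ℓ - 5 / 2) - 1)
        + 1 / (((j : ℝ) - ℓ - 5 / 2) + ℓ + 2)) * (A * |c j| + (j : ℝ) * (j - 1) * K) with hKm
      have hKm0 : 0 ≤ Km := by
        have h1 : (0 : ℝ) < ℓ - ((j : ℝ) - ℓ - 5 / 2) - 1 := by
          linarith [(Nat.cast_le.2 hjℓ : (j : ℝ) ≤ ℓ)]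
        have h2 : (0 : ℝ) < ((j : ℝ) - ℓ - 5 / 2) + ℓ + 2 := by linarith
        have h3 : 0 ≤ (j : ℝ) * (j - 1) * K := by
          have : 0 ≤ (j : ℝ) * (j - 1) := by nlinarith
          positivity
        positivity
      set K' : ℝ := max K Km with hK'
      refine ⟨fun i => if i = j then g else δ i, K', hK0.trans (le_max_left _ _), fun i hi => ?_⟩
      rcases eq_or_ne i j with hij | hij
      · -- the new rung
        subst hij
        have hsimp : (fun i => if i = j then g else δ i) j = g := by simp
        have hsimp2 : (fun i => if i = j then g else δ i) (j - 2) = d := by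
          have : j - 2 ≠ j := by omega
          simp [this, hd]
        rw [hsimp, hsimp2]
        refine ⟨hg2, fun x => (hgsol x).congr_deriv (by ring), fun x hx => ?_⟩
        obtain ⟨h1, h2⟩ := hgb x hx
        have hxp : ∀ r : ℝ, 0 ≤ x ^ r := fun r => Real.rpow_nonneg (by linarith) _
        constructor
        · rw [show (j : ℝ) - ℓ - 5 / 2 + 2 = (j : ℝ) - ℓ - 1 / 2 by ring] at h1
          exact h1.trans (mul_le_mul_of_nonneg_right (le_max_right _ _) (hxp _))
        · rw [show (j : ℝ) - ℓ - 5 / 2 + 1 = (j : ℝ) - ℓ - 3 / 2 by ring] at h2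
          exact h2.trans (mul_le_mul_of_nonneg_right (le_max_right _ _) (hxp _))
      · -- old rungs
        have hi' : i ≤ n := by omega
        have hsimp : (fun i => if i = j then g else δ i) i = δ i := by simp [hij]
        have hsimp2 : (fun i => if i = j then g else δ i) (i - 2) = δ (i - 2) := by
          have : i - 2 ≠ j := by omega
          simp [this]
        rw [hsimp, hsimp2]
        obtain ⟨h1, h2, h3⟩ := hδ i hi'
        refine ⟨h1, h2, fun x hx => ?_⟩
        obtain ⟨h4, h5⟩ := h3 x hx
        have hxp : ∀ r : ℝ, 0 ≤ x ^ r := fun r => Real.rpow_nonneg (by linarith) _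
        exact ⟨h4.trans (mul_le_mul_of_nonneg_right (le_max_left _ _) (hxp _)),
          h5.trans (mul_le_mul_of_nonneg_right (le_max_left _ _) (hxp _))⟩
  -- Step 5: assemble `et_j = e_j + δ_j`
  obtain ⟨δ, K, hK0, hδ⟩ := main ℓ le_rfl
  refine ⟨fun j y => e j y + δ j y, x₁, K, by linarith, hK0, fun j hj => (heC j).add (hδ j hj).1,
    fun j hj x hx => ?_, fun j hj x hx => ?_⟩
  · obtain ⟨hdC, hdsol, -⟩ := hδ j hj
    have hed : Differentiable ℝ (deriv (e j)) := by
      have h := (contDiff_const_mul_iota_pow hι (ℓ - j) (c j) (m := 2)).differentiable_iteratedDeriv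
        1 (by norm_num)
      rwa [iteratedDeriv_one] at h
    have he1 : Differentiable ℝ (e j) := (heC j).differentiable (by norm_num)
    have hd1 : Differentiable ℝ (δ j) := hdC.differentiable (by norm_num)
    have hderiv : deriv (fun y => e j y + δ j y) = fun y => deriv (e j) y + deriv (δ j) y := by
      funext y; exact deriv_fun_add (he1 y) (hd1 y)
    rw [hderiv, deriv_fun_add (hed x) (hdsol x).differentiableAt, (hdsol x).deriv]
    have hex := exact_chain_deriv_deriv hιeq ℓ hc hc1 hj hx
    simp only [he] at hex ⊢
    rw [hex]
    simp only [hW]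
    ring
  · obtain ⟨hdC, hdsol, hdb⟩ := hδ j hj
    obtain ⟨h1, h2⟩ := hdb x hx
    have he1 : Differentiable ℝ (e j) := (heC j).differentiable (by norm_num)
    have hd1 : Differentiable ℝ (δ j) := hdC.differentiable (by norm_num)
    constructor
    · simpa [he] using h1
    · rw [deriv_fun_add (he1 x) (hd1 x)]
      simpa [he] using h2

end TrueChain

end Literature.Analysis.ODE
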